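import Literature.Probability.Percolation.TriLowestCrossingSwitch
import HarnessLib

/-!
# The five-arm site of the lowest crossing, I: simple sequences, the region above the explored set, the frontier

Topic `Literature/Probability/Percolation`; family `crit-perc`. PROOFS ONLY (no new definition of a
named fact). First brick of a separation-free proof of the two-radii **five-arm lower bound**
`P_p(A₅(m, n)) ≥ c (m/n)²` below `L(p)` (W. Werner, *Lectures on two-dimensional critical
percolation*, PCMI 2009, Lecture 6, §3, second a priori estimate; P. Nolin, *Near-critical
percolation in two dimensions*, EJP 13 (2008), Thm. 24 (ii) with Thm. 27 [arXiv 0711.4948: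
Thm. 23 (ii), Thm. 26]), which is the hypothesis of the tree's
`Werner2009_fourArm_lowerBound_of_fiveArm` (`ArmEventsReimer.lean`) and hence the last input of the
named fact `Werner2009_fourArm_lowerBound` (`NearCriticalFourArmFacts.lean`).

The lower bound is Nolin's construction of a five-arm site (proof of Thm. 24 (ii), arXiv p. 17:
"condition on the lowest black left-right crossing `c` … any site on this crossing has already `3`
arms … with positive probability `c` is connected to the top side by a black path included in
`[-N/8,0] × [-N,N]`, and another white path included in `[0,N/8] × [-N,N]` … consider the last
vertex `v` before `v₂` that is connected to the top side: it is not hard to see that there is a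
white arm from `v` to the top side"). This file supplies the planar-topological groundwork of that
"not hard to see", entirely from the crossing lemma `PathIn.tri_crossings_meet` (Kesten 1982,
§2.2) in the parallelogram `R(M, N) = [0, M] × [0, N]` of `𝕋`, for the exploration of the tree's
`TriLowestCrossingSwitch.lean` (`explored M N ω`: the bottom side, the closed cluster of the bottom
side `botCluster M N ω` and its neighbours; the lowest open crossing runs inside it,
`TriQuad.exists_lr_subset_explored`):

* `SimpleSeq` — a site sequence `κ 0, …, κ n` inside a set, consecutive sites adjacent, pairwise
  distinct; every `PathIn` contains one with the same ends (`exists_simpleSeq_of_pathIn`, loop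
  erasure), and its segments are paths (`SimpleSeq.pathIn_seg`).
* `aboveSet M N ω` — **the region above the explored set**: the sites of `R ∖ explored` joined to
  the top side inside `R ∖ explored`.
* `mem_omega_of_adj_aboveSet`, `SimpleSeq.exists_eq_of_adj_aboveSet` — **the frontier lemma**: an
  explored site adjacent to the region above is open, and lies on EVERY open left–right sequence
  `κ` inside the explored set (a bottom–top path through it and the closed cluster below it meets
  `κ`, and can only meet it there).

## References

* P. Nolin, Near-critical percolation in two dimensions, *Electron. J. Probab.* 13 (2008)
  1562–1623, §5.2, proof of Thm. 24 (ii) (arXiv 0711.4948: Thm. 23 (ii), p. 17) [Nolin2008].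
* W. Werner, *Lectures on two-dimensional critical percolation*, IAS/Park City Math. Ser. 16
  (2009), Lecture 6, §3; first exercise sheet, "Five-arm exponent" [WernerPCMI2009].
* H. Kesten, *Percolation theory for mathematicians*, Birkhäuser (1982), §2.2–2.3 (paths crossing
  a rectangle meet; the lowest crossing) [KestenPTM1982].
* B. Bollobás, O. Riordan, *Percolation*, CUP (2006), Ch. 3, Lemma 1 [BollobasRiordan2006].

## Mathlib / tree

Tree: `PathIn` (`SitePaths.lean`), `PathIn.tri_crossings_meet` (`TriCrossingsMeet.lean`),
`explored`, `botCluster`, `mem_explored`, `mem_botCluster`, `mem_explored_of_adj`,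
`mem_botCluster_of_mem_bottomSide`, `mem_botCluster_of_adj`, `botCluster_subset`, `explored_subset`,
`mem_coe_rectangle`, `mem_coe_topSide`, … (`TriLowestCrossingSwitch.lean`), `rectangle`, `topSide`,
`bottomSide` (`Crossings.lean`). Mathlib: `Relation.ReflTransGen` induction.
-/

noncomputable section

open Set

namespace Literature.Probability.Percolation

open LatticeModels

/-! ### Simple site sequences -/

/-- **A simple `𝕋`-sequence of length `n` inside `A`**: the sites `κ 0, …, κ n` lie in `A`,
consecutive sites are adjacent in `𝕋`, and they are pairwise distinct (values of `κ` beyond `n`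
are irrelevant). [cite: KestenPTM1982, §2.2 (self-avoiding paths)] -/
structure SimpleSeq (A : Set (Site 2)) (κ : ℕ → Site 2) (n : ℕ) : Prop where
  mem : ∀ k, k ≤ n → κ k ∈ A
  adj : ∀ k, k < n → triGraph.Adj (κ k) (κ (k + 1))
  inj : ∀ k l, k ≤ n → l ≤ n → κ k = κ l → k = l

namespace SimpleSeq

variable {A S : Set (Site 2)} {κ : ℕ → Site 2} {n : ℕ}

/-- A simple sequence inside `A` is inside any larger set. [folklore] -/
theorem mono {A' : Set (Site 2)} (h : SimpleSeq A κ n) (hAA' : A ⊆ A') : SimpleSeq A' κ n :=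
  ⟨fun k hk => hAA' (h.mem k hk), h.adj, h.inj⟩

/-- Truncation of a simple sequence. [folklore] -/
theorem trunc (h : SimpleSeq A κ n) {m : ℕ} (hm : m ≤ n) : SimpleSeq A κ m :=
  ⟨fun k hk => h.mem k (hk.trans hm), fun k hk => h.adj k (lt_of_lt_of_le hk hm),
    fun k l hk hl => h.inj k l (hk.trans hm) (hl.trans hm)⟩

/-- **Segments are paths**: if the sites `κ a, …, κ b` (`a ≤ b ≤ n`) lie in `S`, then `S`
contains a `𝕋`-path from `κ a` to `κ b`. [folklore] -/
theorem pathIn_seg (h : SimpleSeq A κ n) {a b : ℕ} (hab : a ≤ b) (hbn : b ≤ n)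
    (hS : ∀ k, a ≤ k → k ≤ b → κ k ∈ S) : PathIn triGraph S (κ a) (κ b) := by
  induction b with
  | zero =>
    obtain rfl : a = 0 := Nat.le_zero.1 hab
    exact PathIn.refl (hS 0 le_rfl le_rfl)
  | succ b ih =>
    rcases Nat.lt_or_eq_of_le hab with hlt | rfl
    · have hab' : a ≤ b := Nat.lt_succ_iff.1 hlt
      exact (ih hab' (Nat.le_of_succ_le hbn) fun k hk hkb => hS k hk (Nat.le_succ_of_le hkb)).tail
        (h.adj b (Nat.lt_of_succ_le hbn)) (hS (b + 1) hab le_rfl)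
    · exact PathIn.refl (hS _ le_rfl le_rfl)

/-- Segments are paths, reversed. [folklore] -/
theorem pathIn_seg' (h : SimpleSeq A κ n) {a b : ℕ} (hab : a ≤ b) (hbn : b ≤ n)
    (hS : ∀ k, a ≤ k → k ≤ b → κ k ∈ S) : PathIn triGraph S (κ b) (κ a) :=
  (h.pathIn_seg hab hbn hS).symm

/-- The whole sequence is a path inside `A`. [folklore] -/
theorem pathIn (h : SimpleSeq A κ n) : PathIn triGraph A (κ 0) (κ n) :=
  h.pathIn_seg (Nat.zero_le _) le_rfl fun k _ hk => h.mem k hk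

/-- Distinct indices carry distinct sites. [folklore] -/
theorem ne (h : SimpleSeq A κ n) {k l : ℕ} (hk : k ≤ n) (hl : l ≤ n) (hkl : k ≠ l) : κ k ≠ κ l :=
  fun heq => hkl (h.inj k l hk hl heq)

/-- **Reversal** of a simple sequence. [folklore] -/
theorem reverse (h : SimpleSeq A κ n) : SimpleSeq A (fun k => κ (n - k)) n := by
  refine ⟨fun k _ => h.mem _ (Nat.sub_le _ _), fun k hk => ?_, fun k l hk hl hkl => ?_⟩
  · have h1 : n - (k + 1) < n := by omega
    have h2 : n - (k + 1) + 1 = n - k := by omega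
    have := h.adj _ h1
    rw [h2] at this
    exact this.symm
  · have := h.inj _ _ (Nat.sub_le n k) (Nat.sub_le n l) hkl
    omega

end SimpleSeq

/-- **Loop erasure**: a `𝕋`-path inside `A` from `x` to `y` contains a simple sequence inside `A`
from `x` to `y`. [cite: KestenPTM1982, §2.2 (every path contains a self-avoiding path with the same endpoints)] -/
theorem exists_simpleSeq_of_pathIn {A : Set (Site 2)} {x y : Site 2} (h : PathIn triGraph A x y) :
    ∃ n : ℕ, ∃ κ : ℕ → Site 2, SimpleSeq A κ n ∧ κ 0 = x ∧ κ n = y := by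
  obtain ⟨hx, h⟩ := h
  induction h with
  | refl => exact ⟨0, fun _ => x, ⟨fun _ _ => hx, fun k hk => absurd hk (Nat.not_lt_zero _),
      fun k l hk hl _ => by omega⟩, rfl, rfl⟩
  | @tail b c _ hbc ih =>
    obtain ⟨n, κ, hκ, h0, hn⟩ := ih
    by_cases hc : ∃ k, k ≤ n ∧ κ k = c
    · obtain ⟨k, hk, hkc⟩ := hc
      exact ⟨k, κ, hκ.trunc hk, h0, hkc⟩
    · have hc' : ∀ k, k ≤ n → κ k ≠ c := fun k hk hkc => hc ⟨k, hk, hkc⟩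
      refine ⟨n + 1, fun m => if m ≤ n then κ m else c, ⟨fun m hm => ?_, fun m hm => ?_,
        fun m l hm hl hml => ?_⟩, by simp [h0], by simp⟩
      · by_cases hmn : m ≤ n
        · simp only [hmn, if_true]; exact hκ.mem m hmn
        · simp only [hmn, if_false]; exact hbc.2
      · rcases Nat.lt_or_eq_of_le (Nat.lt_succ_iff.1 hm) with hlt | rfl
        · have h1 : m ≤ n := hlt.le
          have h2 : m + 1 ≤ n := hlt
          simp only [h1, h2, if_true]
          exact hκ.adj m hlt
        · simp only [le_refl, if_true, Nat.not_succ_le_self, if_false, hn]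
          exact hbc.1
      · by_cases hmn : m ≤ n <;> by_cases hln : l ≤ n
        · simp only [hmn, hln, if_true] at hml; exact hκ.inj m l hmn hln hml
        · simp only [hmn, hln, if_true, if_false] at hml; exact absurd hml (hc' m hmn)
        · simp only [hmn, hln, if_true, if_false] at hml; exact absurd hml.symm (hc' l hln)
        · omega

/-! ### The region above the explored set -/

variable {M N : ℕ}

/-- **The region above the explored set** of the lowest open crossing of `R(M, N)`: the sites of
`R(M, N)` off `explored M N ω` that are joined to the top side by a `𝕋`-path of `R(M, N)` avoiding
`explored M N ω` ("the region above the crossing, where percolation remains unbiased", Nolin 2008,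
proof of Thm. 24 (ii); Kesten 1982, §2.3). [cite: Nolin2008, §5.2, proof of Thm. 24 (ii) (arXiv 0711.4948: Thm. 23 (ii), p. 17)] -/
def aboveSet (M N : ℕ) (ω : Set (Site 2)) : Set (Site 2) :=
  {z | ∃ t ∈ topSide M N, PathIn triGraph (↑(rectangle M N) \ ↑(explored M N ω)) z t}

variable {ω : Set (Site 2)}

/-- A site of the region above lies in the parallelogram and off the explored set. [folklore] -/
theorem mem_rectangle_of_mem_aboveSet {z : Site 2} (hz : z ∈ aboveSet M N ω) :
    z ∈ rectangle M N ∧ z ∉ explored M N ω := by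
  obtain ⟨t, -, hp⟩ := hz
  exact ⟨Finset.mem_coe.1 hp.left_mem.1, fun h => hp.left_mem.2 (Finset.mem_coe.2 h)⟩

/-- The region above is closed under `𝕋`-steps inside `R ∖ explored`. [folklore] -/
theorem mem_aboveSet_of_adj {z w : Site 2} (hz : z ∈ aboveSet M N ω) (hzw : triGraph.Adj z w)
    (hw : w ∈ rectangle M N) (hwE : w ∉ explored M N ω) : w ∈ aboveSet M N ω := by
  obtain ⟨t, ht, hp⟩ := hz
  have hw' : w ∈ (↑(rectangle M N) : Set (Site 2)) \ ↑(explored M N ω) :=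
    ⟨Finset.mem_coe.2 hw, fun h => hwE (Finset.mem_coe.1 h)⟩
  exact ⟨t, ht, (PathIn.of_adj hw' hp.left_mem hzw.symm).trans hp⟩

/-- A path of `R ∖ explored` ending in the region above starts in it. [folklore] -/
theorem mem_aboveSet_of_pathIn {z w : Site 2} (hw : w ∈ aboveSet M N ω)
    (hp : PathIn triGraph (↑(rectangle M N) \ ↑(explored M N ω)) z w) : z ∈ aboveSet M N ω := by
  obtain ⟨t, ht, hq⟩ := hw
  exact ⟨t, ht, hp.trans hq⟩

/-- An unexplored top-side site lies in the region above. [folklore] -/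
theorem mem_aboveSet_of_mem_topSide {t : Site 2} (ht : t ∈ topSide M N) (htE : t ∉ explored M N ω) :
    t ∈ aboveSet M N ω := by
  refine ⟨t, ht, PathIn.refl ?_⟩
  exact ⟨Finset.mem_coe.2 (Finset.mem_of_mem_filter t ht), fun h => htE (Finset.mem_coe.1 h)⟩

/-- **No site of the closed cluster of the bottom side is adjacent to the region above** (its
neighbours in `R` are explored). [folklore] -/
theorem not_adj_aboveSet_of_mem_botCluster {e g : Site 2} (he : e ∈ botCluster M N ω)
    (hg : g ∈ aboveSet M N ω) (heg : triGraph.Adj e g) : False :=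
  (mem_rectangle_of_mem_aboveSet hg).2 (mem_explored_of_adj he heg (mem_rectangle_of_mem_aboveSet hg).1)

/-- **An explored site adjacent to the region above is open** (a closed explored site lies in the
closed cluster of the bottom side, whose neighbours are explored). [folklore] -/
theorem mem_omega_of_adj_aboveSet {e g : Site 2} (he : e ∈ explored M N ω) (hg : g ∈ aboveSet M N ω)
    (heg : triGraph.Adj e g) : e ∈ ω := by
  by_contra heω
  obtain ⟨heR, hcase⟩ := mem_explored.1 he
  rcases hcase with hb | ⟨u, hu, rfl | hue⟩
  · exact not_adj_aboveSet_of_mem_botCluster (mem_botCluster_of_mem_bottomSide hb heω) hg heg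
  · exact not_adj_aboveSet_of_mem_botCluster hu hg heg
  · exact not_adj_aboveSet_of_mem_botCluster (mem_botCluster_of_adj hu hue heR heω) hg heg

/-- Coordinates of the sites of a subset of the parallelogram (the format of
`PathIn.tri_crossings_meet`). [folklore] -/
theorem coord_of_subset_rectangle {A : Set (Site 2)} (hA : A ⊆ ↑(rectangle M N)) :
    ∀ z ∈ A, (0 : ℤ) ≤ z 0 ∧ z 0 ≤ M ∧ (0 : ℤ) ≤ z 1 ∧ z 1 ≤ N := fun _ hz =>
  mem_coe_rectangle.1 (hA hz)

/-! ### The frontier lemma -/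

/-- **The frontier lemma.** Let `κ 0, …, κ n` be a simple sequence of open explored sites from the
left side to the right side of `R(M, N)` (an open left–right crossing inside the explored set, as
provided by `TriQuad.exists_lr_subset_explored`). Then every explored site `e` adjacent to a site `g`
of the region above is one of the `κ k`: the bottom–top path "closed cluster of the bottom side →
`e` → `g` → top side" meets the left–right path `κ` (`PathIn.tri_crossings_meet`), and `e` is its
only open explored site. (Kesten 1982, §2.3: the lowest crossing is the boundary of the region
below it.) [cite: KestenPTM1982, §2.2–2.3 (paths crossing a rectangle meet; the lowest crossing)] [cite: Nolin2008, §5.2, proof of Thm. 24 (ii) (arXiv 0711.4948: p. 17)] -/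
theorem SimpleSeq.exists_eq_of_adj_aboveSet {κ : ℕ → Site 2} {n : ℕ}
    (hκ : SimpleSeq (↑(explored M N ω) ∩ ω) κ n) (h0 : κ 0 0 = 0) (hn : κ n 0 = M)
    {e g : Site 2} (he : e ∈ explored M N ω) (hg : g ∈ aboveSet M N ω) (heg : triGraph.Adj e g) :
    ∃ k, k ≤ n ∧ κ k = e := by
  -- the path `κ` and its site set
  set A : Set (Site 2) := {z | ∃ k, k ≤ n ∧ κ k = z} with hAdef
  have hAsub : A ⊆ ↑(explored M N ω) ∩ ω := by
    rintro z ⟨k, hk, rfl⟩; exact hκ.mem k hk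
  have hAR : A ⊆ ↑(rectangle M N) := fun z hz =>
    Finset.mem_coe.2 (explored_subset ω (Finset.mem_coe.1 (hAsub hz).1))
  have hP : PathIn triGraph A (κ 0) (κ n) :=
    hκ.pathIn_seg (Nat.zero_le _) le_rfl fun k _ hk => ⟨k, hk, rfl⟩
  -- the bottom–top path through `e`
  obtain ⟨t, ht, hgt⟩ := hg
  have ht1 : t 1 = N := (mem_coe_topSide.1 (Finset.mem_coe.2 ht)).2
  set A' : Set (Site 2) := (↑(rectangle M N) ∩ ωᶜ) ∪ {e} ∪ (↑(rectangle M N) \ ↑(explored M N ω))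
    with hA'def
  have hA'R : A' ⊆ ↑(rectangle M N) := by
    rintro z ((hz | hz) | hz)
    · exact hz.1
    · rw [mem_singleton_iff.1 hz]; exact Finset.mem_coe.2 (explored_subset ω he)
    · exact hz.1
  have heA' : e ∈ A' := Or.inl (Or.inr (mem_singleton e))
  have hget : PathIn triGraph A' e t :=
    (PathIn.of_adj heA' (Or.inr hgt.left_mem) heg).trans (hgt.mono fun z hz => Or.inr hz)
  -- a common site of `κ` and a bottom–top path inside `A'` is `e`
  have key : ∀ {b : Site 2}, b 1 = 0 → PathIn triGraph A' b t → ∃ k, k ≤ n ∧ κ k = e := by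
    intro b hb hQ
    obtain ⟨z, hzA, hzA'⟩ := PathIn.tri_crossings_meet (L := 0) (R := M) (B := 0) (T := N)
      (coord_of_subset_rectangle hAR) (coord_of_subset_rectangle hA'R) hP h0 hn hQ hb ht1
    obtain ⟨k, hk, rfl⟩ := hzA
    have hz := hAsub ⟨k, hk, rfl⟩
    rcases hzA' with (hz' | hz') | hz'
    · exact absurd hz.2 hz'.2
    · exact ⟨k, hk, mem_singleton_iff.1 hz'⟩
    · exact absurd hz.1 hz'.2
  obtain ⟨heR, hcase⟩ := mem_explored.1 he
  rcases hcase with hb | ⟨u, hu, rfl | hue⟩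
  · -- `e` on the bottom side
    exact key (mem_coe_bottomSide.1 (Finset.mem_coe.2 hb)).2 hget
  · -- `e` in the closed cluster: impossible (it is adjacent to the region above)
    exact (not_adj_aboveSet_of_mem_botCluster hu ⟨t, ht, hgt⟩ heg).elim
  · -- `e` adjacent to `u` in the closed cluster of the bottom side
    obtain ⟨b, hb, hbu⟩ := mem_botCluster.1 hu
    have hbu' : PathIn triGraph A' b u := hbu.mono fun z hz => Or.inl (Or.inl hz)
    exact key (mem_coe_bottomSide.1 (Finset.mem_coe.2 hb)).2 ((hbu'.tail hue heA').trans hget)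

/-! ### Clusters of a set -/

/-- A path inside `A` from `x` runs inside the `A`-cluster of `x`. [folklore] -/
theorem PathIn.pathIn_cluster {A : Set (Site 2)} {x y : Site 2} (h : PathIn triGraph A x y) :
    PathIn triGraph {z | PathIn triGraph A x z} x y := by
  obtain ⟨hx, h⟩ := h
  induction h with
  | refl => exact PathIn.refl (PathIn.refl hx)
  | @tail b c _ hbc ih => exact ih.tail hbc.1 (ih.right_mem.tail hbc.1 hbc.2)

/-! ### Open left–right sequences inside the explored set -/

/-- **An open left–right sequence inside the explored set**: a simple sequence of open explored
sites of `R(M, N)` whose ends lie on the left and right sides, in either order (the site set of the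
lowest open crossing, `TriQuad.exists_lr_subset_explored`, or of its reversal). [cite: KestenPTM1982, §2.3 (the lowest crossing)] -/
structure LowSeq (M N : ℕ) (ω : Set (Site 2)) (κ : ℕ → Site 2) (n : ℕ) : Prop where
  seq : SimpleSeq (↑(explored M N ω) ∩ ω) κ n
  ends : (κ 0 0 = 0 ∧ κ n 0 = M) ∨ (κ 0 0 = M ∧ κ n 0 = 0)

namespace LowSeq

variable {κ : ℕ → Site 2} {n : ℕ}

/-- Reversal of an open left–right sequence. [folklore] -/
theorem reverse (h : LowSeq M N ω κ n) : LowSeq M N ω (fun k => κ (n - k)) n := by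
  refine ⟨h.seq.reverse, ?_⟩
  simp only [Nat.sub_zero, Nat.sub_self]
  rcases h.ends with ⟨h0, hn⟩ | ⟨h0, hn⟩
  · exact Or.inr ⟨hn, h0⟩
  · exact Or.inl ⟨hn, h0⟩

/-- The sites of the sequence are open explored sites of the parallelogram. [folklore] -/
theorem mem (h : LowSeq M N ω κ n) {k : ℕ} (hk : k ≤ n) :
    κ k ∈ explored M N ω ∧ κ k ∈ ω ∧ κ k ∈ rectangle M N :=
  ⟨Finset.mem_coe.1 (h.seq.mem k hk).1, (h.seq.mem k hk).2,
    explored_subset ω (Finset.mem_coe.1 (h.seq.mem k hk).1)⟩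

/-- A site of the sequence is not in the region above (it is explored). [folklore] -/
theorem not_mem_aboveSet (h : LowSeq M N ω κ n) {k : ℕ} (hk : k ≤ n) : κ k ∉ aboveSet M N ω :=
  fun hk' => (mem_rectangle_of_mem_aboveSet hk').2 (h.mem hk).1

/-- **The crossing lemma for the sequence**: a path inside `A ⊆ R` joining the two ends of `κ` and
a bottom–top path inside `A' ⊆ R` share a site (`PathIn.tri_crossings_meet`, in the orientation of
`κ`). [cite: KestenPTM1982, §2.2 (paths crossing a rectangle must intersect)] -/
theorem meet (h : LowSeq M N ω κ n) {A A' : Set (Site 2)} (hA : A ⊆ ↑(rectangle M N))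
    (hA' : A' ⊆ ↑(rectangle M N)) (hP : PathIn triGraph A (κ 0) (κ n)) {b t : Site 2}
    (hQ : PathIn triGraph A' b t) (hb : b 1 = 0) (ht : t 1 = N) : ∃ z, z ∈ A ∧ z ∈ A' := by
  rcases h.ends with ⟨h0, hn⟩ | ⟨h0, hn⟩
  · exact PathIn.tri_crossings_meet (L := 0) (R := M) (B := 0) (T := N)
      (coord_of_subset_rectangle hA) (coord_of_subset_rectangle hA') hP h0 hn hQ hb ht
  · exact PathIn.tri_crossings_meet (L := 0) (R := M) (B := 0) (T := N)
      (coord_of_subset_rectangle hA) (coord_of_subset_rectangle hA') hP.symm hn h0 hQ hb ht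

end LowSeq

/-- **A bottom–top path through an open explored site.** If `e` is an open explored site, `u` a
neighbour of `e` and `P` contains a path from `u` to `t`, then some bottom-side site `b` is joined
to `t` inside `(R ∩ ωᶜ) ∪ {e} ∪ P`: through the closed cluster of the bottom side up to `e`
(`mem_explored`), then `u` and `P`. [folklore] -/
theorem exists_bottom_pathIn {e u t : Site 2} (he : e ∈ explored M N ω) (heω : e ∈ ω)
    {P : Set (Site 2)} (heu : triGraph.Adj e u) (hut : PathIn triGraph P u t) :
    ∃ b : Site 2, b 1 = 0 ∧ PathIn triGraph ((↑(rectangle M N) ∩ ωᶜ) ∪ {e} ∪ P) b t := by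
  set A' : Set (Site 2) := (↑(rectangle M N) ∩ ωᶜ) ∪ {e} ∪ P with hA'def
  have heA' : e ∈ A' := Or.inl (Or.inr (mem_singleton e))
  have het : PathIn triGraph A' e t :=
    (PathIn.of_adj heA' (Or.inr hut.left_mem) heu).trans (hut.mono fun z hz => Or.inr hz)
  obtain ⟨heR, hcase⟩ := mem_explored.1 he
  rcases hcase with hb | ⟨u', hu', rfl | hue⟩
  · exact ⟨e, (mem_coe_bottomSide.1 (Finset.mem_coe.2 hb)).2, het⟩
  · exact absurd heω (botCluster_subset hu').2
  · obtain ⟨b, hb, hbu⟩ := mem_botCluster.1 hu'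
    have hbu' : PathIn triGraph A' b u' := hbu.mono fun z hz => Or.inl (Or.inl hz)
    exact ⟨b, (mem_coe_bottomSide.1 (Finset.mem_coe.2 hb)).2, (hbu'.tail hue heA').trans het⟩

/-! ### Feet of the sequence: where open and closed paths from the top side land -/

/-- **An open foot**: the index `k` is an open foot of `κ` if some open site `o` of the region above,
adjacent to `κ k`, is joined to the top side by open sites of the region above ("`v₁` … the
respective sites on `c` where they arrive", Nolin 2008, proof of Thm. 24 (ii)). [cite: Nolin2008, §5.2, proof of Thm. 24 (ii) (arXiv 0711.4948: p. 17)] -/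
def IsFootO (M N : ℕ) (ω : Set (Site 2)) (κ : ℕ → Site 2) (k : ℕ) : Prop :=
  ∃ o, triGraph.Adj (κ k) o ∧ o ∈ aboveSet M N ω ∧ o ∈ ω ∧
    ∃ t ∈ topSide M N, PathIn triGraph (aboveSet M N ω ∩ ω) o t

/-- **A closed foot**: the same with closed sites. [cite: Nolin2008, §5.2, proof of Thm. 24 (ii) (arXiv 0711.4948: p. 17)] -/
def IsFootK (M N : ℕ) (ω : Set (Site 2)) (κ : ℕ → Site 2) (k : ℕ) : Prop :=
  ∃ u, triGraph.Adj (κ k) u ∧ u ∈ aboveSet M N ω ∧ u ∉ ω ∧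
    ∃ t ∈ topSide M N, PathIn triGraph (aboveSet M N ω ∩ ωᶜ) u t

/-! ### Three consequences of the crossing lemma -/

namespace LowSeq

variable {κ : ℕ → Site 2} {n : ℕ}

/-- The site set of a segment of the sequence lies in the parallelogram. [folklore] -/
theorem seg_subset (h : LowSeq M N ω κ n) (p : ℕ → Prop) :
    {z | ∃ l, l ≤ n ∧ p l ∧ κ l = z} ⊆ ↑(rectangle M N) := by
  rintro z ⟨l, hl, -, rfl⟩; exact Finset.mem_coe.2 (h.mem hl).2.2

/-- The region above lies in the parallelogram. [folklore] -/
theorem aboveSet_subset_rectangle : aboveSet M N ω ⊆ ↑(rectangle M N) := fun _ hz =>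
  Finset.mem_coe.2 (mem_rectangle_of_mem_aboveSet hz).1

/-- **No chord over a frontier index.** If `κ m ∼ κ m'` with `m < k < m'` then `κ k` is not
adjacent to the region above: the shortcut path `κ 0 … κ m, κ m' … κ n` avoids `κ k`, yet it would
have to meet the bottom–top path through `κ k` (`exists_bottom_pathIn`, `LowSeq.meet`). [cite: KestenPTM1982, §2.2–2.3] -/
theorem no_chord (h : LowSeq M N ω κ n) {m k m' : ℕ} (hmk : m < k) (hkm' : k < m') (hm'n : m' ≤ n)
    (hadj : triGraph.Adj (κ m) (κ m')) {g : Site 2} (hg : g ∈ aboveSet M N ω)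
    (hkg : triGraph.Adj (κ k) g) : False := by
  have hkn : k ≤ n := (hkm'.le).trans hm'n
  -- the shortcut
  set A : Set (Site 2) := {z | ∃ l, l ≤ n ∧ (l ≤ m ∨ m' ≤ l) ∧ κ l = z} with hAdef
  have hP : PathIn triGraph A (κ 0) (κ n) := by
    have h1 : PathIn triGraph A (κ 0) (κ m) :=
      h.seq.pathIn_seg (Nat.zero_le _) (by omega) fun l _ hl => ⟨l, by omega, Or.inl hl, rfl⟩
    have h2 : PathIn triGraph A (κ m') (κ n) :=
      h.seq.pathIn_seg hm'n le_rfl fun l hl hln => ⟨l, hln, Or.inr hl, rfl⟩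
    exact (h1.tail hadj ⟨m', hm'n, Or.inr le_rfl, rfl⟩).trans h2
  -- the bottom–top path through `κ k`
  obtain ⟨t, ht, hgt⟩ := hg
  have ht1 : t 1 = N := (mem_coe_topSide.1 (Finset.mem_coe.2 ht)).2
  obtain ⟨b, hb, hQ⟩ := exists_bottom_pathIn (h.mem hkn).1 (h.mem hkn).2.1 hkg hgt
  have hA'R : (↑(rectangle M N) ∩ ωᶜ) ∪ {κ k} ∪ (↑(rectangle M N) \ ↑(explored M N ω)) ⊆
      ↑(rectangle M N) := by
    rintro z ((hz | hz) | hz)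
    · exact hz.1
    · rw [mem_singleton_iff.1 hz]; exact Finset.mem_coe.2 (h.mem hkn).2.2
    · exact hz.1
  obtain ⟨z, ⟨l, hl, hlm, rfl⟩, hz'⟩ := h.meet (h.seg_subset _) hA'R hP hQ hb ht1
  rcases hz' with (hz' | hz') | hz'
  · exact hz'.2 (h.mem hl).2.1
  · have := h.seq.inj l k hl hkn (mem_singleton_iff.1 hz')
    omega
  · exact hz'.2 (Finset.mem_coe.2 (h.mem hl).1)

/-- **No open cluster of the region above straddles a closed foot.** If open sites `ya ∼ κ a` and
`yb ∼ κ b` of the region above are joined by open sites of the region above, then no index `j`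
with `a < j < b` is a closed foot: the arch `κ 0 … κ a, ya ⇝ yb, κ b … κ n` consists of open sites
and avoids `κ j`, yet it would have to meet the bottom–top path "closed cluster → `κ j` → closed path
to the top" whose only open site is `κ j`. [cite: Nolin2008, §5.2, proof of Thm. 24 (ii) (arXiv 0711.4948: p. 17)] [cite: KestenPTM1982, §2.2] -/
theorem no_straddle_footK (h : LowSeq M N ω κ n) {a j b : ℕ} (haj : a < j) (hjb : j < b) (hbn : b ≤ n)
    {ya yb : Site 2} (hya : triGraph.Adj (κ a) ya) (hyb : triGraph.Adj (κ b) yb)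
    (harch : PathIn triGraph (aboveSet M N ω ∩ ω) ya yb) (hj : IsFootK M N ω κ j) : False := by
  have hjn : j ≤ n := hjb.le.trans hbn
  set A : Set (Site 2) := {z | ∃ l, l ≤ n ∧ (l ≤ a ∨ b ≤ l) ∧ κ l = z} ∪ (aboveSet M N ω ∩ ω)
    with hAdef
  have hAR : A ⊆ ↑(rectangle M N) :=
    union_subset (h.seg_subset _) (inter_subset_left.trans aboveSet_subset_rectangle)
  have hP : PathIn triGraph A (κ 0) (κ n) := by
    have h1 : PathIn triGraph A (κ 0) (κ a) :=
      h.seq.pathIn_seg (Nat.zero_le _) (by omega) fun l _ hl => Or.inl ⟨l, by omega, Or.inl hl, rfl⟩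
    have h2 : PathIn triGraph A (κ b) (κ n) :=
      h.seq.pathIn_seg hbn le_rfl fun l hl hln => Or.inl ⟨l, hln, Or.inr hl, rfl⟩
    have h3 : PathIn triGraph A ya yb := harch.mono subset_union_right
    exact (((h1.tail hya (Or.inr harch.left_mem)).trans h3).tail hyb.symm
      (Or.inl ⟨b, hbn, Or.inr le_rfl, rfl⟩)).trans h2
  obtain ⟨u, hju, -, huω, t, ht, hut⟩ := hj
  have ht1 : t 1 = N := (mem_coe_topSide.1 (Finset.mem_coe.2 ht)).2
  obtain ⟨b₀, hb₀, hQ⟩ := exists_bottom_pathIn (h.mem hjn).1 (h.mem hjn).2.1 hju hut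
  have hA'R : (↑(rectangle M N) ∩ ωᶜ) ∪ {κ j} ∪ (aboveSet M N ω ∩ ωᶜ) ⊆ ↑(rectangle M N) := by
    rintro z ((hz | hz) | hz)
    · exact hz.1
    · rw [mem_singleton_iff.1 hz]; exact Finset.mem_coe.2 (h.mem hjn).2.2
    · exact aboveSet_subset_rectangle hz.1
  obtain ⟨z, hzA, hz'⟩ := h.meet hAR hA'R hP hQ hb₀ ht1
  rcases hzA with ⟨l, hl, hlm, rfl⟩ | ⟨hz1, hz2⟩
  · rcases hz' with (hz' | hz') | hz'
    · exact hz'.2 (h.mem hl).2.1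
    · have := h.seq.inj l j hl hjn (mem_singleton_iff.1 hz')
      omega
    · exact hz'.2 (h.mem hl).2.1
  · rcases hz' with (hz' | hz') | hz'
    · exact hz'.2 hz2
    · exact h.not_mem_aboveSet hjn (mem_singleton_iff.1 hz' ▸ hz1)
    · exact hz'.2 hz2

/-- **An open cluster of the region above straddling an open foot contains its witness.** If open
sites `ya ∼ κ a`, `yb ∼ κ b` of the region above are joined to `x` by open sites of the region
above, and `a < i < b` where `κ i ∼ o` with `o` an open site of the region above joined to the top
side by open sites of the region above, then `o` is joined to `x` as well: the arch through `x`
avoids `κ i` and meets the bottom–top path "closed cluster → `κ i` → `o` ⇝ top" in an open site of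
the region above, i.e. inside the cluster of `o`. [cite: Nolin2008, §5.2, proof of Thm. 24 (ii) (arXiv 0711.4948: p. 17)] [cite: KestenPTM1982, §2.2] -/
theorem pathIn_of_straddle_footO (h : LowSeq M N ω κ n) {a i b : ℕ} (hai : a < i) (hib : i < b)
    (hbn : b ≤ n) {x ya yb o t : Site 2} (hya : triGraph.Adj (κ a) ya) (hyb : triGraph.Adj (κ b) yb)
    (hxa : PathIn triGraph (aboveSet M N ω ∩ ω) x ya) (hxb : PathIn triGraph (aboveSet M N ω ∩ ω) x yb)
    (hio : triGraph.Adj (κ i) o) (hot : PathIn triGraph (aboveSet M N ω ∩ ω) o t)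
    (ht : t ∈ topSide M N) : PathIn triGraph (aboveSet M N ω ∩ ω) x o := by
  have hin : i ≤ n := hib.le.trans hbn
  -- the cluster of `x` and the arch inside it
  set C : Set (Site 2) := {z | PathIn triGraph (aboveSet M N ω ∩ ω) x z} with hCdef
  have hCsub : C ⊆ aboveSet M N ω ∩ ω := fun z hz => hz.right_mem
  set A : Set (Site 2) := {z | ∃ l, l ≤ n ∧ (l ≤ a ∨ b ≤ l) ∧ κ l = z} ∪ C with hAdef
  have hAR : A ⊆ ↑(rectangle M N) :=
    union_subset (h.seg_subset _) ((hCsub.trans inter_subset_left).trans aboveSet_subset_rectangle)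
  have harch : PathIn triGraph C ya yb := by
    have := (hxa.symm.trans hxb).pathIn_cluster
    exact this.mono fun z (hz : PathIn triGraph _ ya z) => hxa.trans hz
  have hP : PathIn triGraph A (κ 0) (κ n) := by
    have h1 : PathIn triGraph A (κ 0) (κ a) :=
      h.seq.pathIn_seg (Nat.zero_le _) (by omega) fun l _ hl => Or.inl ⟨l, by omega, Or.inl hl, rfl⟩
    have h2 : PathIn triGraph A (κ b) (κ n) :=
      h.seq.pathIn_seg hbn le_rfl fun l hl hln => Or.inl ⟨l, hln, Or.inr hl, rfl⟩
    have h3 : PathIn triGraph A ya yb := harch.mono subset_union_right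
    exact (((h1.tail hya (Or.inr harch.left_mem)).trans h3).tail hyb.symm
      (Or.inl ⟨b, hbn, Or.inr le_rfl, rfl⟩)).trans h2
  -- the bottom–top path through `κ i`, inside the cluster of `o` above
  set P : Set (Site 2) := {z | PathIn triGraph (aboveSet M N ω ∩ ω) o z} with hPdef
  have hPsub : P ⊆ aboveSet M N ω ∩ ω := fun z hz => hz.right_mem
  have ht1 : t 1 = N := (mem_coe_topSide.1 (Finset.mem_coe.2 ht)).2
  obtain ⟨b₀, hb₀, hQ⟩ := exists_bottom_pathIn (h.mem hin).1 (h.mem hin).2.1 hio hot.pathIn_cluster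
  have hA'R : (↑(rectangle M N) ∩ ωᶜ) ∪ {κ i} ∪ P ⊆ ↑(rectangle M N) := by
    rintro z ((hz | hz) | hz)
    · exact hz.1
    · rw [mem_singleton_iff.1 hz]; exact Finset.mem_coe.2 (h.mem hin).2.2
    · exact aboveSet_subset_rectangle (hPsub hz).1
  obtain ⟨z, hzA, hz'⟩ := h.meet hAR hA'R hP hQ hb₀ ht1
  rcases hzA with ⟨l, hl, hlm, rfl⟩ | hzC
  · exfalso
    rcases hz' with (hz' | hz') | hz'
    · exact hz'.2 (h.mem hl).2.1
    · have := h.seq.inj l i hl hin (mem_singleton_iff.1 hz')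
      omega
    · exact h.not_mem_aboveSet hl (hPsub hz').1
  · rcases hz' with (hz' | hz') | hz'
    · exact absurd (hCsub hzC).2 hz'.2
    · exact absurd (mem_singleton_iff.1 hz' ▸ (hCsub hzC).1) (h.not_mem_aboveSet hin)
    · -- `z` lies in both clusters
      exact (show PathIn triGraph _ x z from hzC).trans (show PathIn triGraph _ o z from hz').symm

/-- **The frontier lemma** for an open left–right sequence in either orientation: an explored
site adjacent to the region above is one of the `κ k` (as `SimpleSeq.exists_eq_of_adj_aboveSet`,
through `LowSeq.meet`). [cite: KestenPTM1982, §2.2–2.3] -/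
theorem exists_eq_of_adj_aboveSet (h : LowSeq M N ω κ n) {e g : Site 2} (he : e ∈ explored M N ω)
    (hg : g ∈ aboveSet M N ω) (heg : triGraph.Adj e g) : ∃ k, k ≤ n ∧ κ k = e := by
  have heω : e ∈ ω := mem_omega_of_adj_aboveSet he hg heg
  set A : Set (Site 2) := {z | ∃ l, l ≤ n ∧ True ∧ κ l = z} with hAdef
  have hP : PathIn triGraph A (κ 0) (κ n) :=
    h.seq.pathIn_seg (Nat.zero_le _) le_rfl fun l _ hl => ⟨l, hl, trivial, rfl⟩
  obtain ⟨t, ht, hgt⟩ := hg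
  have ht1 : t 1 = N := (mem_coe_topSide.1 (Finset.mem_coe.2 ht)).2
  obtain ⟨b, hb, hQ⟩ := exists_bottom_pathIn he heω heg hgt
  have hA'R : (↑(rectangle M N) ∩ ωᶜ) ∪ {e} ∪ (↑(rectangle M N) \ ↑(explored M N ω)) ⊆
      ↑(rectangle M N) := by
    rintro z ((hz | hz) | hz)
    · exact hz.1
    · rw [mem_singleton_iff.1 hz]; exact Finset.mem_coe.2 (explored_subset ω he)
    · exact hz.1
  obtain ⟨z, ⟨l, hl, -, rfl⟩, hz'⟩ := h.meet (h.seg_subset _) hA'R hP hQ hb ht1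
  rcases hz' with (hz' | hz') | hz'
  · exact absurd (h.mem hl).2.1 hz'.2
  · exact ⟨l, hl, mem_singleton_iff.1 hz'⟩
  · exact absurd (Finset.mem_coe.2 (h.mem hl).1) hz'.2

end LowSeq

end Literature.Probability.Percolation
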